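import Literature.MathematicalPhysics.QuantumFieldTheory.Balaban1985CMP102.Theorems
import Literature.MathematicalPhysics.QuantumFieldTheory.Balaban1983to89.B10Eq5RegularAction
import Summits.QuantumFields.Balaban3D.Proofs.ScalesArithmetic

/-!
# `Summit.QuantumFields.Balaban3D.Proofs.Reg44Action` — [Balaban1985UV3] the regular-field action input behind (5)_K ⇒ (3):
# `A^η(U_K(U)) ≤ a·|T₁^{(K)}|` with `a = a(g, ε₀)` from the plaquette regularity (44) p. 267 of the minimizer and the upper
# direction of (11) p. 258, ON THE LANE'S CARRIERS (`Setting.Scales`, `Setting.GroupModel`, `Scales.actionEta`) — lane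
# `pub-balaban3d`, seat p4 (LEAF-LEDGER row A13 «Reg44ActionBound», booked 2026-08-22T00:01Z → p4)

HONEST FRAMING (lane PLAN.md §0, binding): see `…Proofs.SectAFirstStep`.  This file is kernel arithmetic on the lane's concrete
lattice and group model; the regularity of the minimizer `U_K(U)` ((44), from [7] = B11 Thm 1, binder b11) is a HYPOTHESIS in the
printed shape, nothing of it is proved here.

WHAT IS PRINTED.  p. 256 = PDF 2 L19–29 (render `…-p002-x2.png`): «χ(U)e^{−O(1)|T_ε|} ≤ ρ_K(U) ≤ e^{O(1)|T_ε|}, |T_ε| = Σ_{x∈T_ε} ε³,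
(3) with a constant O(1) depending on g and ε₀ only. … The constant O(1) goes to ∞ as g → 0. To get a better bound we have to
write explicitly the expression divergent with g.» and L32–39 (5) with «A^η(U_k(U)) = Σ_{p⊂T_η} η^{−1}[1 − Re tr U_k(U, ∂p)],
η = L^{−k}, … |T₁^{(k)}| = Σ_{y∈T₁^{(k)}} 1 = Σ_{x∈T_η} η³ = (L^kε)^{−3}|T_ε|»; p. 267 = PDF 13 L1–3 (render p013): «The
restrictions introduced by the characteristic functions χ_j imply that |U_k(∂p) − 1| < 2L²B₃g_{k−1}p(g_{k−1})η²» ((44), from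
[7] Thm 1 (8) p. 279); p. 258 L17–19 (11): «exp[−(1/g₀²)[1 − Re tr U(∂p)]] = exp[−(1/2g₀²)|U(∂p) − 1|²]».

WHAT LQB / THE LANE ALREADY HAVE (RE-USED BY NAME): `B10Eq5RegularAction.one_sub_nReTr_le_half_opDist1_sq` — the UPPER direction
of (11) for `U ∈ U(N)`, `1 − Re Tr U/N ≤ ½‖U − 1‖²_op` (operator norm; LQB proves the whole mechanism of this file on the OTHER
torus carrier `ConstructiveQFTWave0.GaugeConfig`, `fineAction_le_sites`; here it is redone on the lane's `Setup`/`Setting`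
carriers, which is what the lane's (3) needs); p3's `Terminal3.Reg44ActionBound mk` (drafts/p3/Terminal3.lean) = the
hypothesis of `uvStability3_of_thm1AsPrintedCompact` ((5)_K ∧ this ⇒ (3) with «O(1) depending on g and ε₀ only»).

WHAT THIS FILE PROVES (no `sorry`, axioms standard; theorems only):
* §1 `one_sub_reTr_le` — (11) upper direction for the lane's group AS TYPED: `1 − Re tr w ≤ ½|w − 1|²` for every `w ∈ G`
  (`GroupModel`: `reTr`, `dist1` pinned to the normalized trace / operator norm of a faithful unitary realisation);
* §2 lattice counts on `Setting.Scales`: `card_plaq_eq` (`#{p ⊂ T^{(j)}} = #T^{(j)} · #{μ < ν}`), `card_pairs_d3` (`#{μ < ν} = 3` for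
  the lane's `d = 3`), `sites_eq_eta_cube_mul_card` (`|T₁^{(k)}| = η³·#T_η`, η = L^{−k}: the printed «Σ_{x∈T_η} η³»);
* §3 `actionEta_le_of_plaqRegular` — THE MECHANISM: if every plaquette variable of a configuration `W` on `T_η` satisfies
  `|W(∂p) − 1| ≤ c·η²` (η = L^{−k}) then `A^η(W) ≤ (3/2)·c²·|T₁^{(k)}|` (η⁻¹·½c²η⁴·3η⁻³|T₁^{(k)}|: the powers of η cancel — the
  d = 3 count), for every `k`;
* §4 `reg44ActionBound_of_plaqRegular` — for every construction `mk : Theorems.Construction L`: IF the minimizer `U_K(U)` of every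
  lattice approximation is plaquette-regular on the domain (4) with a constant depending on `(g, ε₀)` only, `|U_K(U)(∂p) − 1| ≤
  δ(g, ε₀)·η_K²` (the shape of (44) at k = K: print's δ = 2L²B₃g_{K−1}p(g_{K−1}), and g_{K−1} = g(ε₀/L)^{1/2} for K ≥ 1), THEN the
  body of `Terminal3.Reg44ActionBound mk` holds with `a = (3/2)·δ(g, ε₀)²` — so p3 gets `Reg44ActionBound (mk₃ 𝔇)` by `exact`
  from the (44)-display hypothesis on the expansion data (LEAF-LEDGER A13).
-/

namespace Summit.QuantumFields.Balaban3D.Proofs.Reg44Action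

open Literature.MathematicalPhysics.QuantumFieldTheory.Balaban1983to89
open Literature.MathematicalPhysics.QuantumFieldTheory.Balaban1985CMP102.Setting
open Literature.MathematicalPhysics.QuantumFieldTheory.Balaban1985CMP102.Theorems (Construction)
open Finset

/-! ## §1 (11), upper direction, for the group model -/

section Group

variable {G : Type} [GaugeGroup G] [MeasurableSpace G]

/-- **(11) p. 258, upper direction, for the lane's group AS TYPED**: `1 − Re tr w ≤ ½|w − 1|²` for every `w ∈ G` (`Re tr` = the
normalized real trace, `|·−1|` = the operator-norm distance of the faithful unitary realisation `𝔊.ρ`, `GroupModel.reTr_eq/dist1_eq`).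
LQB `B10Eq5RegularAction.one_sub_nReTr_le_half_opDist1_sq` transported along the spine's interface. [cite: Balaban1985UV3, (11) p.258] -/
theorem one_sub_reTr_le (𝔊 : GroupModel G) (w : G) : 1 - reTr w ≤ (1 / 2) * dist1 w ^ 2 := by
  haveI : Nonempty (Fin 𝔊.N) := ⟨⟨0, 𝔊.N_pos⟩⟩
  rw [𝔊.reTr_eq, 𝔊.dist1_eq]
  exact B10Eq5RegularAction.one_sub_nReTr_le_half_opDist1_sq (𝔊.mem_unitary w)

end Group

/-! ## §2 Lattice counts: plaquettes per site, `|T₁^{(k)}| = η³·#T_η` -/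

section Counts

/-- `#{p ⊂ T^{(j)}} = #T^{(j)} · #{(μ, ν) : μ < ν}` for the tree's torus (`Setup.Plaq` = (site; μ < ν)). [folklore] -/
theorem card_plaq_eq (P : Params) (j : ℕ) :
    Fintype.card (Plaq P j) = Fintype.card (Site P j) * Fintype.card {q : Fin P.d × Fin P.d // q.1 < q.2} := by
  rw [← Fintype.card_prod]
  refine Fintype.card_congr ?_
  exact
    { toFun := fun p => (p.src, ⟨(p.μ, p.ν), p.hμν⟩)
      invFun := fun t => ⟨t.1, t.2.1.1, t.2.1.2, t.2.2⟩
      left_inv := fun _ => rfl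
      right_inv := fun _ => rfl }

variable {L : ℕ} (S : Scales L)

/-- For the lane's lattices (`Params.d = 3` inside `Scales.P`): three coordinate planes, `#{(μ, ν) : μ < ν} = 3`. [folklore] -/
theorem card_pairs_d3 : Fintype.card {q : Fin S.P.d × Fin S.P.d // q.1 < q.2} = 3 := by
  show Fintype.card {q : Fin 3 × Fin 3 // q.1 < q.2} = 3
  decide

/-- `#{p ⊂ T^{(j)}} = 3·#T^{(j)}` on the lane's three-dimensional tori. [folklore] -/
theorem card_plaq_d3 (j : ℕ) : Fintype.card (Plaq S.P j) = 3 * Fintype.card (Site S.P j) := by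
  rw [card_plaq_eq, card_pairs_d3, mul_comm]

/-- p. 256 L39 «|T₁^{(k)}| = Σ_{y∈T₁^{(k)}} 1 = Σ_{x∈T_η} η³ = (L^kε)^{−3}|T_ε|»: the middle expression — `|T₁^{(k)}| = η³·#T_η` with
`η = L^{−k}` (`Scales.eta`), from the last one (`Scales.sites`) and `|T_ε| = ε³#T_ε`. [cite: Balaban1985UV3, (5) p.256] -/
theorem sites_eq_eta_cube_mul_card (k : ℕ) : S.sites k = S.eta k ^ 3 * Fintype.card (Site S.P 0) := by
  unfold Scales.sites B10.sitesRun Scales.eta Params.eta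
  have hε : S.ε ≠ 0 := S.ε_pos.ne'
  have hL : (S.P.L : ℝ) = L := rfl
  rw [ScalesArithmetic.volT_eq S, hL, inv_pow (L : ℝ) k]
  have hε3 : (S.ε⁻¹) ^ 3 * S.ε ^ 3 = 1 := by rw [inv_pow, inv_mul_cancel₀ (pow_ne_zero 3 hε)]
  calc ((L : ℝ) ^ k * S.ε)⁻¹ ^ 3 * ((Fintype.card (Site S.P 0) : ℝ) * S.ε ^ 3)
      = ((L : ℝ) ^ k)⁻¹ ^ 3 * (Fintype.card (Site S.P 0) : ℝ) * ((S.ε⁻¹) ^ 3 * S.ε ^ 3) := by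
        rw [mul_inv, mul_pow]; ring
    _ = ((L : ℝ) ^ k)⁻¹ ^ 3 * (Fintype.card (Site S.P 0) : ℝ) := by rw [hε3, mul_one]

/-- `0 < η = L^{−k}`. [folklore] -/
theorem eta_pos (k : ℕ) : 0 < S.eta k := by
  unfold Scales.eta Params.eta
  have hL : (0 : ℝ) < S.P.L := by
    have h := S.hL.2
    show (0 : ℝ) < (L : ℝ)
    exact_mod_cast (show 0 < L by omega)
  positivity

end Counts

/-! ## §3 The mechanism: plaquette-regular configurations have action `O(1)·|T₁^{(k)}|` -/

section Mechanism

variable {L : ℕ} (S : Scales L) {G : Type} [GaugeGroup G] [MeasurableSpace G]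

/-- **Regular fields have small η-action** (p. 256 «the expression divergent with g» made finite; the printed mechanism of (44) +
(11) + the plaquette count): if a configuration `W` on the finest torus `T_η` has `|W(∂p) − 1| ≤ c·η²` for every plaquette
(`η = L^{−k}`), then `A^η(W) = Σ_p η^{−1}[1 − Re tr W(∂p)] ≤ (3/2)·c²·|T₁^{(k)}|` — per plaquette `1 − Re tr ≤ ½c²η⁴` (§1), times
`η⁻¹`, times `#{p ⊂ T_η} = 3·#T_η = 3η⁻³|T₁^{(k)}|` (§2): the powers of η cancel (d = 3).  Kernel-checked on the lane's carriers.
[cite: Balaban1985UV3, (5) p.256 + (44) p.267 + (11) p.258] -/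
theorem actionEta_le_of_plaqRegular (𝔊 : GroupModel G) (k : ℕ) {W : GaugeField S.P 0 G} {c : ℝ}
    (hW : ∀ p : Plaq S.P 0, dist1 (GaugeField.plaqHol W p) ≤ c * S.eta k ^ 2) :
    S.actionEta k W ≤ (3 / 2) * c ^ 2 * S.sites k := by
  have hη := eta_pos S k
  -- per plaquette: η⁻¹(1 − Re tr W(∂p)) ≤ η⁻¹ · ½ (c η²)²
  have hterm : ∀ p : Plaq S.P 0,
      (S.eta k)⁻¹ * (1 - reTr (GaugeField.plaqHol W p)) ≤ (S.eta k)⁻¹ * ((1 / 2) * (c * S.eta k ^ 2) ^ 2) := by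
    intro p
    refine mul_le_mul_of_nonneg_left ?_ (inv_nonneg.mpr hη.le)
    refine (one_sub_reTr_le 𝔊 _).trans ?_
    have h0 : 0 ≤ dist1 (GaugeField.plaqHol W p) := GaugeGroup.dist1_nonneg _
    have h1 : dist1 (GaugeField.plaqHol W p) ^ 2 ≤ (c * S.eta k ^ 2) ^ 2 := pow_le_pow_left₀ h0 (hW p) 2
    linarith
  unfold Scales.actionEta wilsonAction
  calc ∑ p : Plaq S.P 0, (S.eta k)⁻¹ * (1 - reTr (GaugeField.plaqHol W p))
      ≤ ∑ _p : Plaq S.P 0, (S.eta k)⁻¹ * ((1 / 2) * (c * S.eta k ^ 2) ^ 2) := sum_le_sum fun p _ => hterm p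
    _ = (Fintype.card (Plaq S.P 0) : ℝ) * ((S.eta k)⁻¹ * ((1 / 2) * (c * S.eta k ^ 2) ^ 2)) := by
        rw [sum_const, card_univ, nsmul_eq_mul]
    _ = (3 / 2) * c ^ 2 * S.sites k := by
        rw [card_plaq_d3, sites_eq_eta_cube_mul_card]
        push_cast
        field_simp

end Mechanism

/-! ## §4 LEAF-LEDGER A13: `Reg44ActionBound` from the (44)-regularity of the minimizer -/

/-- **The regular-field action input of (3)** (p3's `Terminal3.Reg44ActionBound mk`, LEAF-LEDGER A13) FROM THE PLAQUETTE REGULARITY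
(44) p. 267 L1–3 of the minimizer at `k = K`: for a construction `mk` of the run objects, if on the domain (4) of `χ_K` every
lattice approximation's minimal configuration satisfies `|U_K(U)(∂p) − 1| ≤ δ(g, ε₀)·η_K²` with `δ` a function of the coupling `g`
and the terminal spacing `ε₀` only (print: δ = 2L²B₃g_{K−1}p(g_{K−1}), g_{K−1} = g(ε₀/L)^{1/2} for K ≥ 1 — [7] Thm 1 (8) via the
restrictions χ_K; a HYPOTHESIS here, binder b11), then for every `(g, ε₀)` ONE `a = (3/2)δ(g, ε₀)² ≥ 0` bounds
`A^η(U_K(U)) ≤ a·|T₁^{(K)}|` for all those approximations — the statement `Reg44ActionBound mk` UNFOLDED (p3: `exact` this).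
Kernel-checked (§3). [cite: Balaban1985UV3, (3) p.256 + (44) p.267] -/
theorem reg44ActionBound_of_plaqRegular {L : ℕ} (mk : Construction L) (δ : ℝ → ℝ → ℝ)
    (hreg : ∀ (G : Type) [GaugeGroup G] [MeasurableSpace G] [HaarData G] (𝔊 : GroupModel G) (S : Scales L)
      (U : GaugeField S.P S.K G), (mk G 𝔊 S).chi S.K U ≠ 0 →
        ∀ p : Plaq S.P 0, dist1 (GaugeField.plaqHol ((mk G 𝔊 S).Uk S.K U) p) ≤ δ S.g S.ε₀ * S.eta S.K ^ 2) :
    ∀ (G : Type) [GaugeGroup G] [MeasurableSpace G] [HaarData G] (𝔊 : GroupModel G) (g ε₀ : ℝ),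
      ∃ a : ℝ, 0 ≤ a ∧ ∀ S : Scales L, S.g = g → S.ε₀ = ε₀ →
        ∀ U : GaugeField S.P S.K G, (mk G 𝔊 S).chi S.K U ≠ 0 → (mk G 𝔊 S).mainTerm S.K U ≤ a * S.sites S.K := by
  intro G _ _ _ 𝔊 g ε₀
  refine ⟨(3 / 2) * δ g ε₀ ^ 2, by positivity, fun S hSg hSε U hχ => ?_⟩
  have h := actionEta_le_of_plaqRegular S 𝔊 S.K (W := (mk G 𝔊 S).Uk S.K U) (c := δ g ε₀)
    (fun p => by rw [← hSg, ← hSε]; exact hreg G 𝔊 S U hχ p)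
  exact h

end Summit.QuantumFields.Balaban3D.Proofs.Reg44Action
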